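import Mathlib
import Literature.Analysis.FluidPDE.ClassicalSolutionRescale
import Literature.Analysis.FluidPDE.SpaceTimeRescaling
import Summits.NavierStokesRegularity.NavierStokesRegularity.Theorems.LandauTailLandauTailBlowupEngine
import Summits.NavierStokesRegularity.NavierStokesRegularity.Theorems.LandauTailLandauTailBlowupTypeIIFatou

/-!
# The slice / core-ball theorem: a Landau-tailed solution is never Type I on the core balls

Helper file for the crux item `stmt-NavierStokesRegularity-1944` (`LandauTail.LandauTailBlowup`,
line `registered`), registered stub `landauTail_scaledSliceNorm_unbounded` ("the slice / core-ball
theorem"): if a classical unit-viscosity Navier–Stokes solution `(u, p)` on `ℝ³ × (−1, 0)` has the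
pointwise parabolic tail `√(−t) u(t, √(−t) y) → U(y)` (`t → 0⁻`, `y ≠ 0`) towards a nonzero
steady `(−1)`-homogeneous profile `(U, P)` smooth off the origin (a Landau solution), then for
every real `q > 2` the scale-invariant slice norms on the parabolic core balls,
`(−t)^{(q−3)/2} ∫_{B_{√(−t)}} |u(t, x)|^q dx`, are unbounded on `(−1, 0)`.

* `landauTail_slice_identity`: `∫_{B_1} |√(−t) u(t, √(−t) y)|^q dy = (−t)^{(q−3)/2} ∫_{B_{√(−t)}} |u(t)|^q`
  (spatial change of variables);
* `landauTail_slice_false_of_three_le`: the case `q ≥ 3`, Fatou's lemma on the slices against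
  `∫_{B_1} |U|^q = ∞` (`landauTail_lintegral_profile_rpow_eq_top`);
* `landauTail_shiftedRescaling_classical`, `landauTail_shiftedRescaling_tendsto`,
  `landauTail_shiftedRescaling_lintegral_le`: the shifted Navier–Stokes rescalings
  `w_ρ(τ, y) = ρ u(−2ρ² + ρ² τ, ρ y)` are classical on `(−1, 0)`, converge pointwise to `U`, and a
  slice bound makes them bounded in `L^q((−1,0) × B_1)` for `q ≤ 3` (the core balls `B_ρ` of the
  window `(−3ρ², −2ρ²)` lie inside the core balls `B_{√(−t)}`);
* `landauTail_scaledSliceNorm_unbounded`: for `2 < q < 3` the engine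
  `landauTail_false_of_rescalings_Lq_bounded` (no `L^q`-bounded classical sequence converges to a
  Landau flow) finishes the proof.

References: D. Chae, Math. Ann. 338 (2007), Thm 1.5 and p. 8; G. Koch, N. Nadirashvili,
G. Seregin, V. Šverák, Acta Math. 203 (2009), §6; L. D. Landau (1944).
-/

set_option linter.dupNamespace false

namespace Summit.NavierStokesRegularity.NavierStokesRegularity.Theorems

open MeasureTheory Set Filter Topology Metric Function Literature.Analysis.FluidPDE
open scoped ENNReal NNReal

/-- **Slice identity** [folklore; spatial scaling of Lebesgue measure on `ℝ³`]: for `t < 0`,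
`q ≥ 0` and any field `v : ℝ³ → ℝ³`,
`∫_{B_1} ‖√(0 - t) • v (√(0 - t) • y)‖^q dy = (−t)^{(q−3)/2} ∫_{B_{√(−t)}} ‖v‖^q`
(substitute `x = √(−t) y`, `dx = (−t)^{3/2} dy`). -/
theorem landauTail_slice_identity (v : EuclideanSpace ℝ (Fin 3) → EuclideanSpace ℝ (Fin 3))
    {q : ℝ} (hq : 0 ≤ q) {t : ℝ} (ht : t < 0) :
    ∫⁻ y in ball (0 : EuclideanSpace ℝ (Fin 3)) 1,
        ‖Real.sqrt (0 - t) • v (Real.sqrt (0 - t) • y)‖ₑ ^ q =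
      ENNReal.ofReal ((-t) ^ ((q - 3) / 2)) *
        ∫⁻ x in ball (0 : EuclideanSpace ℝ (Fin 3)) (Real.sqrt (-t)), ‖v x‖ₑ ^ q := by
  rw [zero_sub]
  have hnt : 0 < -t := neg_pos.2 ht
  set c : ℝ := Real.sqrt (-t) with hc_def
  have hc : 0 < c := Real.sqrt_pos.2 hnt
  have key : c ^ q * (c ^ 3)⁻¹ = (-t) ^ ((q - 3) / 2) := by
    rw [← Real.sq_sqrt hnt.le, ← hc_def, ← Real.rpow_natCast c 2, ← Real.rpow_mul hc.le,
      show ((2 : ℕ) : ℝ) * ((q - 3) / 2) = q - (3 : ℕ) by push_cast; ring, Real.rpow_sub hc,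
      Real.rpow_natCast, div_eq_mul_inv]
  have h2 : ∫⁻ y in ball (0 : EuclideanSpace ℝ (Fin 3)) 1, ‖v (c • y)‖ₑ ^ q =
      ENNReal.ofReal (c ^ 3)⁻¹ * ∫⁻ x in ball (0 : EuclideanSpace ℝ (Fin 3)) c, ‖v x‖ₑ ^ q := by
    have h := setLIntegral_preimage_comp_space_affine hc (0 : EuclideanSpace ℝ (Fin 3))
      (fun x => ‖v x‖ₑ ^ q) (ball 0 c)
    rw [space_affine_preimage_ball hc, sub_zero, smul_zero, div_self hc.ne',
      finrank_euclideanSpace_fin] at h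
    simpa only [zero_add] using h
  simp_rw [enorm_smul, ENNReal.mul_rpow_of_nonneg _ _ hq]
  rw [lintegral_const_mul' _ _ (ENNReal.rpow_ne_top_of_nonneg hq enorm_ne_top), h2, ← mul_assoc,
    Real.enorm_eq_ofReal hc.le, ENNReal.ofReal_rpow_of_pos hc, ← ENNReal.ofReal_mul (by positivity),
    key]

/-- **The case `q ≥ 3`: Fatou on the slices** [folklore; Fatou's lemma]: if the slices `u t`,
`t ∈ (−1, 0)`, are continuous, `√(0 - t) • u t (√(0 - t) • y) → U y` as `t → 0⁻` for `y ≠ 0`,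
and `U` is continuous off the origin, `(−1)`-homogeneous and nonzero, then no bound
`(−t)^{(q−3)/2} ∫_{B_{√(−t)}} ‖u(t)‖^q ≤ M` on `(−1, 0)` is possible for `q ≥ 3`: along
`t_k = −1/(k+2)` the rescaled slices converge a.e. on `B_1` to `U ∉ L^q(B_1)`
(`landauTail_lintegral_profile_rpow_eq_top`), while by the slice identity their `L^q(B_1)` norms
are the bounded scaled slice norms. -/
theorem landauTail_slice_false_of_three_le
    (u : ℝ → EuclideanSpace ℝ (Fin 3) → EuclideanSpace ℝ (Fin 3))
    (U : EuclideanSpace ℝ (Fin 3) → EuclideanSpace ℝ (Fin 3))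
    (hu : ∀ t ∈ Ioo (-1 : ℝ) 0, Continuous (u t)) (hUc : ContinuousOn U {0}ᶜ)
    (hhom : ∀ c : ℝ, 0 < c → ∀ x : EuclideanSpace ℝ (Fin 3), U (c • x) = c⁻¹ • U x)
    (hne : ∃ x : EuclideanSpace ℝ (Fin 3), U x ≠ 0)
    (htail : ∀ y : EuclideanSpace ℝ (Fin 3), y ≠ 0 → Tendsto
      (fun t : ℝ => Real.sqrt (0 - t) • u t (Real.sqrt (0 - t) • y)) (𝓝[<] 0) (𝓝 (U y)))
    {q : ℝ} (hq : 3 ≤ q) {M : ℝ≥0}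
    (hM : ∀ t ∈ Ioo (-1 : ℝ) 0, ENNReal.ofReal ((-t) ^ ((q - 3) / 2)) *
      ∫⁻ x in ball (0 : EuclideanSpace ℝ (Fin 3)) (Real.sqrt (-t)), ‖u t x‖ₑ ^ q ≤ M) :
    False := by
  have hq0 : 0 ≤ q := by linarith
  -- a sequence of times `t_k → 0⁻` inside `(−1, 0)`
  obtain ⟨tk, htk_mem, htk_lim⟩ : ∃ tk : ℕ → ℝ, (∀ k, tk k ∈ Ioo (-1 : ℝ) 0) ∧
      Tendsto tk atTop (𝓝[<] 0) := by
    have hpos : ∀ k : ℕ, (0 : ℝ) < ((k : ℝ) + 2)⁻¹ := fun k => inv_pos.2 (by positivity)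
    have hle : ∀ k : ℕ, ((k : ℝ) + 2)⁻¹ ≤ 2⁻¹ := fun k =>
      inv_anti₀ two_pos (le_add_of_nonneg_left (Nat.cast_nonneg _))
    have hlim : Tendsto (fun k : ℕ => -((k : ℝ) + 2)⁻¹) atTop (𝓝 0) := by
      have h := (tendsto_inv_atTop_zero.comp
        (tendsto_atTop_add_const_right atTop (2 : ℝ) tendsto_natCast_atTop_atTop)).neg
      rw [neg_zero] at h
      exact h
    refine ⟨fun k => -((k : ℝ) + 2)⁻¹, fun k => ⟨?_, neg_neg_of_pos (hpos k)⟩,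
      tendsto_nhdsWithin_iff.2 ⟨hlim, Eventually.of_forall fun k => neg_neg_of_pos (hpos k)⟩⟩
    have h2 : (2 : ℝ)⁻¹ < 1 := by norm_num
    linarith [hle k]
  -- the rescaled slices and their a.e. limit on `B_1`
  set v : ℕ → EuclideanSpace ℝ (Fin 3) → EuclideanSpace ℝ (Fin 3) :=
    fun k y => Real.sqrt (0 - tk k) • u (tk k) (Real.sqrt (0 - tk k) • y)
  have hvm : ∀ k, AEMeasurable (fun y => ‖v k y‖ₑ ^ q)
      (volume.restrict (ball (0 : EuclideanSpace ℝ (Fin 3)) 1)) := by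
    intro k
    have hc : Continuous (v k) := by
      show Continuous fun y => Real.sqrt (0 - tk k) • u (tk k) (Real.sqrt (0 - tk k) • y)
      exact ((hu _ (htk_mem k)).comp (continuous_const_smul (Real.sqrt (0 - tk k)))).const_smul
        (Real.sqrt (0 - tk k))
    exact (hc.measurable.enorm.pow_const q).aemeasurable
  have hae : ∀ᵐ y ∂(volume.restrict (ball (0 : EuclideanSpace ℝ (Fin 3)) 1)),
      liminf (fun k => ‖v k y‖ₑ ^ q) atTop = ‖U y‖ₑ ^ q := by
    refine ae_restrict_of_ae ?_
    filter_upwards [compl_mem_ae_iff.2 (measure_singleton (0 : EuclideanSpace ℝ (Fin 3)))]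
      with y hy
    have ht := ((htail y hy).comp htk_lim).enorm
    exact ((ENNReal.continuous_rpow_const.tendsto _).comp ht).liminf_eq
  -- the slice identity bounds the `L^q(B_1)` norms of the rescaled slices
  have hS : ∀ k, ∫⁻ y in ball (0 : EuclideanSpace ℝ (Fin 3)) 1, ‖v k y‖ₑ ^ q ≤ M := fun k =>
    (landauTail_slice_identity (u (tk k)) hq0 (htk_mem k).2).trans_le (hM _ (htk_mem k))
  -- Fatou
  have hle : ∫⁻ y in ball (0 : EuclideanSpace ℝ (Fin 3)) 1, ‖U y‖ₑ ^ q ≤ M :=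
    calc ∫⁻ y in ball (0 : EuclideanSpace ℝ (Fin 3)) 1, ‖U y‖ₑ ^ q
        = ∫⁻ y in ball (0 : EuclideanSpace ℝ (Fin 3)) 1, liminf (fun k => ‖v k y‖ₑ ^ q) atTop :=
          (lintegral_congr_ae hae).symm
      _ ≤ liminf (fun k => ∫⁻ y in ball (0 : EuclideanSpace ℝ (Fin 3)) 1, ‖v k y‖ₑ ^ q) atTop :=
          lintegral_liminf_le' hvm
      _ ≤ M := liminf_le_of_frequently_le' (Frequently.of_forall hS)
  rw [landauTail_lintegral_profile_rpow_eq_top U hUc hhom hne q hq] at hle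
  exact ENNReal.coe_ne_top (top_le_iff.1 hle)

/-- **The shifted rescalings are classical solutions** (Koch–Nadirashvili–Seregin–Šverák 2009,
§6, (6.2); scaling and translation covariance): if `(u, p)` is a classical unit-viscosity solution
of the unforced system on the time set `(−1, 0)` and `0 < ρ ≤ 1/2`, then
`w(τ, y) = ρ u(−2ρ² + ρ² τ, ρ y)`, `π(τ, y) = ρ² p(−2ρ² + ρ² τ, ρ y)` is again a classical
solution on `(−1, 0)` (the window `−2ρ² + ρ²(−1, 0) = (−3ρ², −2ρ²)` lies in `(−1, 0)`). -/
theorem landauTail_shiftedRescaling_classical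
    {u : ℝ → EuclideanSpace ℝ (Fin 3) → EuclideanSpace ℝ (Fin 3)}
    {p : ℝ → EuclideanSpace ℝ (Fin 3) → ℝ}
    (hcl : IsClassicalNSSolutionOn (Ioo (-1 : ℝ) 0) 1 0 u p) {ρ : ℝ} (hρ : 0 < ρ) (hρ2 : ρ ≤ 2⁻¹) :
    IsClassicalNSSolutionOn (Ioo (-1 : ℝ) 0) 1 0
      (ρ • stPull (ρ ^ 2) ρ (-(2 * ρ ^ 2)) (0 : EuclideanSpace ℝ (Fin 3)) u)
      (ρ ^ 2 • stPull (ρ ^ 2) ρ (-(2 * ρ ^ 2)) (0 : EuclideanSpace ℝ (Fin 3)) p) := by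
  refine (hcl.nsRescale_translate_zero hρ (-(2 * ρ ^ 2)) 0).mono ?_ (uniqueDiffOn_Ioo _ _)
  intro τ hτ
  show -(2 * ρ ^ 2) + ρ ^ 2 * τ ∈ Ioo (-1 : ℝ) 0
  have hρsq : ρ ^ 2 ≤ 4⁻¹ := by
    nlinarith [mul_le_mul hρ2 hρ2 hρ.le (by norm_num : (0 : ℝ) ≤ 2⁻¹)]
  have hρ2pos : 0 < ρ ^ 2 := pow_pos hρ 2
  constructor
  · nlinarith [mul_pos hρ2pos (by linarith [hτ.1] : (0 : ℝ) < τ + 1)]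
  · nlinarith [mul_neg_of_pos_of_neg hρ2pos hτ.2]

/-- **Pointwise limit of the shifted rescalings** [folklore]: if `U` is `(−1)`-homogeneous and
`√(0 - t) • u t (√(0 - t) • y) → U y` as `t → 0⁻` for every `y ≠ 0`, then for `ρ_n → 0⁺`,
`τ < 2` and `y ≠ 0`, `ρ_n u(−2ρ_n² + ρ_n² τ, ρ_n y) → U y`: these are the Navier–Stokes
rescalings `u_{ρ_n}(τ − 2, y)` of `landauTail_nsRescale_tendsto_profile`. -/
theorem landauTail_shiftedRescaling_tendsto
    (u : ℝ → EuclideanSpace ℝ (Fin 3) → EuclideanSpace ℝ (Fin 3))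
    (U : EuclideanSpace ℝ (Fin 3) → EuclideanSpace ℝ (Fin 3))
    (hhom : ∀ c : ℝ, 0 < c → ∀ x : EuclideanSpace ℝ (Fin 3), U (c • x) = c⁻¹ • U x)
    (htail : ∀ y : EuclideanSpace ℝ (Fin 3), y ≠ 0 → Tendsto
      (fun t : ℝ => Real.sqrt (0 - t) • u t (Real.sqrt (0 - t) • y)) (𝓝[<] 0) (𝓝 (U y)))
    {ρ : ℕ → ℝ} (hρ : ∀ n, 0 < ρ n) (hρ0 : Tendsto ρ atTop (𝓝 0)) {τ : ℝ} (hτ : τ < 2)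
    {y : EuclideanSpace ℝ (Fin 3)} (hy : y ≠ 0) :
    Tendsto (fun n => (ρ n • stPull (ρ n ^ 2) (ρ n) (-(2 * ρ n ^ 2))
      (0 : EuclideanSpace ℝ (Fin 3)) u) τ y) atTop (𝓝 (U y)) := by
  have hlim : Tendsto ρ atTop (𝓝[>] 0) :=
    tendsto_nhdsWithin_iff.2 ⟨hρ0, Eventually.of_forall hρ⟩
  have h := (landauTail_nsRescale_tendsto_profile u U hhom htail (τ - 2) (by linarith) y hy).comp
    hlim
  refine h.congr fun n => ?_
  simp only [Function.comp_apply, nsRescale_apply, Pi.smul_apply, stPull_apply, zero_add]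
  rw [show ρ n ^ 2 * (τ - 2) = -(2 * ρ n ^ 2) + ρ n ^ 2 * τ by ring]

/-- **The `L^q(Q_1)` bound for the shifted rescalings** [folklore; parabolic change of
variables and Tonelli]: let `u` be continuous on `(−1, 0) × ℝ³`, `0 < q ≤ 3`, and suppose the
scaled slice norms are bounded, `(−t)^{(q−3)/2} ∫_{B_{√(−t)}} ‖u(t)‖^q ≤ M` for `t ∈ (−1, 0)`.
Then for `0 < ρ ≤ 1/2` the shifted rescaling `w(τ, y) = ρ u(−2ρ² + ρ² τ, ρ y)` satisfies
`∫∫_{(−1,0) × B_1} ‖w‖^q ≤ 3^{(3−q)/2} M`: indeed `∫∫_{Q_1} ‖w‖^q = ρ^{q−5} ∫_{−3ρ²}^{−2ρ²} ∫_{B_ρ} ‖u‖^q`,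
and for `t` in the window `B_ρ ⊆ B_{√(−t)}` and `∫_{B_{√(−t)}} ‖u(t)‖^q ≤ (−t)^{(3−q)/2} M ≤
(3ρ²)^{(3−q)/2} M`, so all powers of `ρ` cancel. -/
theorem landauTail_shiftedRescaling_lintegral_le
    (u : ℝ → EuclideanSpace ℝ (Fin 3) → EuclideanSpace ℝ (Fin 3))
    (hu : ContinuousOn (uncurry u) (Ioo (-1 : ℝ) 0 ×ˢ univ)) {q : ℝ} (hq0 : 0 < q) (hq3 : q ≤ 3)
    {M : ℝ≥0} (hM : ∀ t ∈ Ioo (-1 : ℝ) 0, ENNReal.ofReal ((-t) ^ ((q - 3) / 2)) *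
      ∫⁻ x in ball (0 : EuclideanSpace ℝ (Fin 3)) (Real.sqrt (-t)), ‖u t x‖ₑ ^ q ≤ M)
    {ρ : ℝ} (hρ : 0 < ρ) (hρ2 : ρ ≤ 2⁻¹) :
    ∫⁻ z in Ioo (-1 : ℝ) 0 ×ˢ ball (0 : EuclideanSpace ℝ (Fin 3)) 1,
        ‖(ρ • stPull (ρ ^ 2) ρ (-(2 * ρ ^ 2)) (0 : EuclideanSpace ℝ (Fin 3)) u) z.1 z.2‖ₑ ^ q ≤
      M * ENNReal.ofReal (3 ^ ((3 - q) / 2)) := by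
  set t₀ : ℝ := -(2 * ρ ^ 2) with ht₀
  set e : ℝ := (3 - q) / 2 with he_def
  have he : 0 ≤ e := div_nonneg (by linarith) two_pos.le
  have hρ2pos : 0 < ρ ^ 2 := pow_pos hρ 2
  have hρsq : ρ ^ 2 ≤ 4⁻¹ := by
    nlinarith [mul_le_mul hρ2 hρ2 hρ.le (by norm_num : (0 : ℝ) ≤ 2⁻¹)]
  -- Step 1: `Q_1` is the preimage of the small cylinder `(t₀ - ρ², t₀) × B_ρ`
  have hpre : Ioo (-1 : ℝ) 0 ×ˢ ball (0 : EuclideanSpace ℝ (Fin 3)) 1 =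
      stAffine (ρ ^ 2) ρ t₀ (0 : EuclideanSpace ℝ (Fin 3)) ⁻¹'
        (Ioo (t₀ - ρ ^ 2) t₀ ×ˢ ball 0 ρ) := by
    rw [stAffine_preimage_cylinder hρ2pos hρ, sub_sub_cancel_left, neg_div, div_self hρ2pos.ne',
      sub_self, sub_self, zero_div, smul_zero, div_self hρ.ne']
  -- Step 2: the slice bound inside the window
  have hIoo : Ioo (t₀ - ρ ^ 2) t₀ ⊆ Ioo (-1 : ℝ) 0 := fun t ht =>
    ⟨by linarith [ht.1, hρsq], by linarith [ht.2, hρ2pos]⟩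
  have hslice : ∀ t ∈ Ioo (t₀ - ρ ^ 2) t₀,
      ∫⁻ x in ball (0 : EuclideanSpace ℝ (Fin 3)) ρ, ‖u t x‖ₑ ^ q ≤
        ENNReal.ofReal ((3 * ρ ^ 2) ^ e) * M := by
    intro t ht
    have ht' := hIoo ht
    have hnt : 0 < -t := neg_pos.2 ht'.2
    have h3 : -t ≤ 3 * ρ ^ 2 := by linarith [ht.1]
    have hball : ball (0 : EuclideanSpace ℝ (Fin 3)) ρ ⊆ ball 0 (Real.sqrt (-t)) :=
      ball_subset_ball (Real.le_sqrt_of_sq_le (by linarith [ht.2]))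
    have hA : ENNReal.ofReal ((-t) ^ e) * ENNReal.ofReal ((-t) ^ ((q - 3) / 2)) = 1 := by
      rw [← ENNReal.ofReal_mul (Real.rpow_nonneg hnt.le _), ← Real.rpow_add hnt,
        show e + (q - 3) / 2 = 0 by rw [he_def]; ring, Real.rpow_zero, ENNReal.ofReal_one]
    calc ∫⁻ x in ball (0 : EuclideanSpace ℝ (Fin 3)) ρ, ‖u t x‖ₑ ^ q
        ≤ ∫⁻ x in ball (0 : EuclideanSpace ℝ (Fin 3)) (Real.sqrt (-t)), ‖u t x‖ₑ ^ q :=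
          lintegral_mono_set hball
      _ = ENNReal.ofReal ((-t) ^ e) * (ENNReal.ofReal ((-t) ^ ((q - 3) / 2)) *
            ∫⁻ x in ball (0 : EuclideanSpace ℝ (Fin 3)) (Real.sqrt (-t)), ‖u t x‖ₑ ^ q) := by
          rw [← mul_assoc, hA, one_mul]
      _ ≤ ENNReal.ofReal ((3 * ρ ^ 2) ^ e) * M :=
          mul_le_mul' (ENNReal.ofReal_le_ofReal (Real.rpow_le_rpow hnt.le h3 he)) (hM t ht')
  -- Step 3: Tonelli over the small cylinder
  have hmeas : AEMeasurable (fun z : ℝ × EuclideanSpace ℝ (Fin 3) => ‖u z.1 z.2‖ₑ ^ q)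
      (((volume : Measure ℝ).prod (volume : Measure (EuclideanSpace ℝ (Fin 3)))).restrict
        (Ioo (t₀ - ρ ^ 2) t₀ ×ˢ ball (0 : EuclideanSpace ℝ (Fin 3)) ρ)) :=
    ((hu.mono (prod_mono hIoo (subset_univ _))).aemeasurable
      (measurableSet_Ioo.prod measurableSet_ball)).enorm.pow_const q
  have hcyl : ∫⁻ z in Ioo (t₀ - ρ ^ 2) t₀ ×ˢ ball (0 : EuclideanSpace ℝ (Fin 3)) ρ,
      ‖u z.1 z.2‖ₑ ^ q ≤ ENNReal.ofReal ((3 * ρ ^ 2) ^ e) * M * ENNReal.ofReal (ρ ^ 2) := by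
    rw [Measure.volume_eq_prod, setLIntegral_prod
      (fun z : ℝ × EuclideanSpace ℝ (Fin 3) => ‖u z.1 z.2‖ₑ ^ q) hmeas]
    calc ∫⁻ t in Ioo (t₀ - ρ ^ 2) t₀, ∫⁻ x in ball (0 : EuclideanSpace ℝ (Fin 3)) ρ, ‖u t x‖ₑ ^ q
        ≤ ∫⁻ _ in Ioo (t₀ - ρ ^ 2) t₀, ENNReal.ofReal ((3 * ρ ^ 2) ^ e) * M :=
          setLIntegral_mono' measurableSet_Ioo hslice
      _ = ENNReal.ofReal ((3 * ρ ^ 2) ^ e) * M * ENNReal.ofReal (ρ ^ 2) := by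
          rw [setLIntegral_const, Real.volume_Ioo, sub_sub_cancel]
  -- Step 4: change of variables and the exponent bookkeeping
  have key : ρ ^ q * (ρ ^ 2 * ρ ^ 3)⁻¹ * (3 * ρ ^ 2) ^ e * ρ ^ 2 = 3 ^ e := by
    have hρq : 0 < ρ ^ q := Real.rpow_pos_of_pos hρ q
    have h1 : (ρ ^ 2) ^ e = ρ ^ 3 / ρ ^ q := by
      rw [← Real.rpow_natCast ρ 2, ← Real.rpow_mul hρ.le,
        show ((2 : ℕ) : ℝ) * e = (3 : ℕ) - q by rw [he_def]; push_cast; ring, Real.rpow_sub hρ,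
        Real.rpow_natCast]
    rw [Real.mul_rpow (by norm_num) (sq_nonneg ρ), h1]
    field_simp
  rw [hpre, setLIntegral_enorm_rpow_stRescale hρ2pos hρ t₀ (0 : EuclideanSpace ℝ (Fin 3)) ρ u _
    hq0.le, finrank_euclideanSpace_fin]
  calc ‖ρ‖ₑ ^ q * ENNReal.ofReal (ρ ^ 2 * ρ ^ 3)⁻¹ *
        ∫⁻ z in Ioo (t₀ - ρ ^ 2) t₀ ×ˢ ball (0 : EuclideanSpace ℝ (Fin 3)) ρ, ‖u z.1 z.2‖ₑ ^ q
      ≤ ‖ρ‖ₑ ^ q * ENNReal.ofReal (ρ ^ 2 * ρ ^ 3)⁻¹ *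
        (ENNReal.ofReal ((3 * ρ ^ 2) ^ e) * M * ENNReal.ofReal (ρ ^ 2)) := mul_le_mul' le_rfl hcyl
    _ = M * (ENNReal.ofReal (ρ ^ q) * ENNReal.ofReal (ρ ^ 2 * ρ ^ 3)⁻¹ *
        ENNReal.ofReal ((3 * ρ ^ 2) ^ e) * ENNReal.ofReal (ρ ^ 2)) := by
        rw [Real.enorm_eq_ofReal hρ.le, ENNReal.ofReal_rpow_of_pos hρ]
        ring
    _ = M * ENNReal.ofReal (3 ^ e) := by
        rw [← ENNReal.ofReal_mul (by positivity), ← ENNReal.ofReal_mul (by positivity),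
          ← ENNReal.ofReal_mul (by positivity), key]

/-- **The slice / core-ball theorem** (registered stub of crux stmt-NavierStokesRegularity-1944;
Chae 2007, Thm 1.5 and p. 8, and Koch–Nadirashvili–Seregin–Šverák 2009, §6, transplanted from
the cylinders `Q_r(0,0)` to the parabolic core balls): a classical unit-viscosity Navier–Stokes
solution on `ℝ³ × (−1, 0)` with a pointwise parabolic tail `√(−t) u(t, √(−t) y) → U(y)`
(`t → 0⁻`, `y ≠ 0`) towards a nonzero steady `(−1)`-homogeneous profile smooth off the origin
(a Landau solution) is never of Type I on the core balls `B_{√(−t)}`: for every `q > 2` the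
scale-invariant slice norms `(−t)^{(q−3)/2} ∫_{B_{√(−t)}} ‖u(t)‖^q` are unbounded on `(−1, 0)`.
For `q ≥ 3` this is Fatou on the slices (`landauTail_slice_false_of_three_le`); for
`2 < q < 3` a slice bound would make the shifted rescalings `ρ_n u(−2ρ_n² + ρ_n² τ, ρ_n y)`,
`ρ_n = 1/(n+2)`, bounded in `L^q((−1,0) × B_1)` (`landauTail_shiftedRescaling_lintegral_le`)
while they converge pointwise to the Landau flow `U`, contradicting the momentum-flux engine
`landauTail_false_of_rescalings_Lq_bounded`. -/
theorem landauTail_scaledSliceNorm_unbounded : ∀ (u : ℝ → EuclideanSpace ℝ (Fin 3) → EuclideanSpace ℝ (Fin 3)) (p : ℝ → EuclideanSpace ℝ (Fin 3) → ℝ) (U : EuclideanSpace ℝ (Fin 3) → EuclideanSpace ℝ (Fin 3)) (P : EuclideanSpace ℝ (Fin 3) → ℝ), (ContDiffOn ℝ (⊤ : ℕ∞) U {0}ᶜ ∧ ContDiffOn ℝ (⊤ : ℕ∞) P {0}ᶜ ∧ (∀ x : EuclideanSpace ℝ (Fin 3), x ≠ 0 → Literature.Analysis.FluidPDE.convect U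 U x + gradient P x = (1 : ℝ) • Laplacian.laplacian U x) ∧ (∀ x : EuclideanSpace ℝ (Fin 3), x ≠ 0 → Literature.Analysis.FluidPDE.VectorCalculus.divergence U x = 0) ∧ (∀ c : ℝ, 0 < c → ∀ x : EuclideanSpace ℝ (Fin 3), U (c • x) = c⁻¹ • U x) ∧ (∃ x : EuclideanSpace ℝ (Fin 3), U x ≠ 0)) → Literature.Analysis.FluidPDE.IsClassicalNSSolutionOn (Set.Ioo (-1) 0) 1 0 u p → (∀ y : EuclideanSpace ℝ (Fin 3), y ≠ 0 → Filter.Tendsto (fun t : ℝ => Real.sqrt (0 - t) • u t (Real.sqrt (0 - t) • y)) (nhdsWithin 0 (Set.Iio 0)) (nhds (U y))) → ∀ q : ℝ, 2 < q → ¬ ∃ M : NNReal, ∀ t ∈ Set.Ioo (-1 : ℝ) 0, ENNReal.ofReal ((-t) ^ ((q - 3) / 2)) * ∫⁻ x in Metric.ball (0 : EuclideanSpace ℝ (Fin 3)) (Real.sqrt (-t)), ‖u t x‖ₑ ^ q ≤ M := by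
  intro u p U P hprof hcl htail q hq hbd
  obtain ⟨M, hM⟩ := hbd
  have hUc : ContinuousOn U {0}ᶜ := hprof.1.continuousOn
  have hhom := hprof.2.2.2.2.1
  have hne := hprof.2.2.2.2.2
  rcases le_or_gt 3 q with hq3 | hq3
  · -- `q ≥ 3`: Fatou on the slices
    exact landauTail_slice_false_of_three_le u U (fun t ht => (hcl.contDiff_velocity ht).continuous)
      hUc hhom hne htail hq3 hM
  · -- `2 < q < 3`: the engine, fed with the shifted rescalings at scales `ρ_n = 1/(n+2)`
    have hq0 : 0 < q := by linarith
    obtain ⟨ρ, hρ, hρ2, hρ0⟩ : ∃ ρ : ℕ → ℝ, (∀ n, 0 < ρ n) ∧ (∀ n, ρ n ≤ 2⁻¹) ∧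
        Tendsto ρ atTop (𝓝 0) :=
      ⟨fun n => ((n : ℝ) + 2)⁻¹, fun n => inv_pos.2 (by positivity),
        fun n => inv_anti₀ two_pos (le_add_of_nonneg_left (Nat.cast_nonneg _)),
        tendsto_inv_atTop_zero.comp
          (tendsto_atTop_add_const_right atTop (2 : ℝ) tendsto_natCast_atTop_atTop)⟩
    have hwcl : ∀ n, IsClassicalNSSolutionOn (Ioo (-1 : ℝ) 0) 1 0
        (ρ n • stPull (ρ n ^ 2) (ρ n) (-(2 * ρ n ^ 2)) (0 : EuclideanSpace ℝ (Fin 3)) u)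
        (ρ n ^ 2 • stPull (ρ n ^ 2) (ρ n) (-(2 * ρ n ^ 2)) (0 : EuclideanSpace ℝ (Fin 3)) p) :=
      fun n => landauTail_shiftedRescaling_classical hcl (hρ n) (hρ2 n)
    have hptw : ∀ τ ∈ Ioo (-1 : ℝ) 0, ∀ y : EuclideanSpace ℝ (Fin 3), y ≠ 0 →
        Tendsto (fun n => (ρ n • stPull (ρ n ^ 2) (ρ n) (-(2 * ρ n ^ 2))
          (0 : EuclideanSpace ℝ (Fin 3)) u) τ y) atTop (𝓝 (U y)) :=
      fun τ hτ y hy => landauTail_shiftedRescaling_tendsto u U hhom htail hρ hρ0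
        (by linarith [hτ.2]) hy
    have hbdd : ∀ n, ∫⁻ z in Ioo (-1 : ℝ) 0 ×ˢ ball (0 : EuclideanSpace ℝ (Fin 3)) 1,
        ‖(ρ n • stPull (ρ n ^ 2) (ρ n) (-(2 * ρ n ^ 2)) (0 : EuclideanSpace ℝ (Fin 3)) u)
          z.1 z.2‖ₑ ^ q ≤ ((M * (3 ^ ((3 - q) / 2) : ℝ).toNNReal : ℝ≥0) : ℝ≥0∞) := by
      intro n
      refine (landauTail_shiftedRescaling_lintegral_le u hcl.smooth_velocity.continuousOn hq0
        hq3.le hM (hρ n) (hρ2 n)).trans_eq ?_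
      rw [ENNReal.coe_mul]
      rfl
    exact landauTail_false_of_rescalings_Lq_bounded
      (fun n => ρ n • stPull (ρ n ^ 2) (ρ n) (-(2 * ρ n ^ 2)) (0 : EuclideanSpace ℝ (Fin 3)) u)
      (fun n => ρ n ^ 2 • stPull (ρ n ^ 2) (ρ n) (-(2 * ρ n ^ 2)) (0 : EuclideanSpace ℝ (Fin 3)) p)
      U P hprof hwcl hptw q hq hq3 ⟨_, hbdd⟩

end Summit.NavierStokesRegularity.NavierStokesRegularity.Theorems
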